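import Summits.Langlands.Langlands.Theses.PolarisationCarving

/-!
# PolarisationCarving — glue of the gen-2 resplit (k = 5) of `UnpolarisedTRCMTypeAutomorphy`

Closes the glue item stmt-Langlands-33403
`PolarisationCarving.UnpolarisedTRCMTypeAutomorphy_of_split2 :
  ConsecutiveWeightAutomorphy → GappedOrdinaryAutomorphy → GappedNonOrdinarySystemAutomorphy →
  GappedNonOrdinaryLoneAutomorphy → IrregularUnpolarisedAutomorphy → UnpolarisedTRCMTypeAutomorphy`
(route-Langlands-PolarisationCarving rev 3; lens-6-g10 node `OrdinaryCompanionCarving`).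

Pure logic: three excluded middles — on the inlined weight-string dial (consecutive ⊆ regular), on the
SlopeLadder clause ORD and on the system clause SYS — written with `by_contra` so that NO dial is restated
(the negated dials are supplied as `fun h => hno (…)` terms whose types are read off the children's binders).
The rev-3 route file no longer declares `GappedWeightAutomorphy` (GW 32659 retired by the resplit), so the
exactness statement is given directly for the five cells.  No definitions, no new mathematics.
-/

set_option linter.dupNamespace false -- project-wide option; `Summit.Langlands.Langlands` is the mandated namespace

namespace Summit.Langlands.Langlands.Theorems

open Summit.Langlands.Langlands.Theses

/-- The k = 5 resplit glue CW → GWO → GNS → GNL → IW → UNP. -/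
theorem UnpolarisedTRCMTypeAutomorphy_of_split2_proof :
    PolarisationCarving.UnpolarisedTRCMTypeAutomorphy_of_split2 := by
  intro hCW hO hS hN hIW K _ _ n hcpt hn ℓ _ ι ρ hirr hgeo htw hunp
  by_contra hno
  refine hno (hIW K n hcpt hn ℓ ι ρ hirr hgeo htw ⟨hunp, fun hr => hno ?_⟩)
  refine hN K n hcpt hn ℓ ι ρ hirr hgeo htw
    ⟨⟨hunp, hr, fun hs => hno ?g1⟩, fun ho => hno ?g2, fun hsys => hno ?g3⟩
  case g1 => exact hCW K n hcpt hn ℓ ι ρ hirr hgeo htw ⟨hunp, hs⟩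
  case g2 =>
    exact hO K n hcpt hn ℓ ι ρ hirr hgeo htw
      ⟨⟨hunp, hr, fun hs => hno (hCW K n hcpt hn ℓ ι ρ hirr hgeo htw ⟨hunp, hs⟩)⟩, ho⟩
  case g3 =>
    exact hS K n hcpt hn ℓ ι ρ hirr hgeo htw
      ⟨⟨hunp, hr, fun hs => hno (hCW K n hcpt hn ℓ ι ρ hirr hgeo htw ⟨hunp, hs⟩)⟩,
        fun ho => hno (hO K n hcpt hn ℓ ι ρ hirr hgeo htw
          ⟨⟨hunp, hr, fun hs => hno (hCW K n hcpt hn ℓ ι ρ hirr hgeo htw ⟨hunp, hs⟩)⟩, ho⟩), hsys⟩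

/-- … and conversely: UNP ⟺ CW ∧ GWO ∧ GNS ∧ GNL ∧ IW (the k = 5 resplit is exact: every cell is the
parent restricted to a sub-box). -/
theorem UnpolarisedTRCMTypeAutomorphy_split2_exact :
    PolarisationCarving.UnpolarisedTRCMTypeAutomorphy ↔
      (PolarisationCarving.ConsecutiveWeightAutomorphy ∧ PolarisationCarving.GappedOrdinaryAutomorphy ∧
        PolarisationCarving.GappedNonOrdinarySystemAutomorphy ∧ PolarisationCarving.GappedNonOrdinaryLoneAutomorphy ∧
          PolarisationCarving.IrregularUnpolarisedAutomorphy) := by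
  constructor
  · intro h
    exact ⟨fun K _ _ n hcpt hn ℓ _ ι ρ hirr hgeo htw hc => h K n hcpt hn ℓ ι ρ hirr hgeo htw hc.1,
      fun K _ _ n hcpt hn ℓ _ ι ρ hirr hgeo htw hc => h K n hcpt hn ℓ ι ρ hirr hgeo htw hc.1.1,
      fun K _ _ n hcpt hn ℓ _ ι ρ hirr hgeo htw hc => h K n hcpt hn ℓ ι ρ hirr hgeo htw hc.1.1,
      fun K _ _ n hcpt hn ℓ _ ι ρ hirr hgeo htw hc => h K n hcpt hn ℓ ι ρ hirr hgeo htw hc.1.1,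
      fun K _ _ n hcpt hn ℓ _ ι ρ hirr hgeo htw hc => h K n hcpt hn ℓ ι ρ hirr hgeo htw hc.1⟩
  · rintro ⟨hCW, hO, hS, hN, hIW⟩
    exact UnpolarisedTRCMTypeAutomorphy_of_split2_proof hCW hO hS hN hIW

end Summit.Langlands.Langlands.Theorems
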